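import Literature.AlgebraicGeometry.Frobenioids.BaseFrobeniusSections
import Literature.AlgebraicGeometry.Frobenioids.PerfFactorial
import Literature.AlgebraicGeometry.Frobenioids.PreFrobenioidDataOfFunctor
import Literature.AlgebraicGeometry.Frobenioids.DivisorMonoidCategoryTheoreticityDefs
import HarnessLib

/-!
# Frobenioids I, §5: Proposition 5.6 (Base-Sections of Frobenius-Trivial Objects), Remark 5.6.1,
# Corollary 5.7 (Category-theoreticity of Base-Sections)

Mochizuki, *The geometry of Frobenioids I: the general theory*, Kyushu J. Math. **62** (2008)
293–400, §5, Proposition 5.6 pp. 105–106 (proof pp. 106–107, 966 words), Remark 5.6.1 p. 107,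
Corollary 5.7 (i)–(iv) pp. 107–108 (proof p. 108 ll. 15–21) [cite: MochizukiFrdI2008, Prop. 5.6 p.105]
[cite: MochizukiFrdI2008, Cor. 5.7 p.107].

**Proposition 5.6 (text, p. 105).** "Suppose that `C` is of model [hence, in particular, isotropic —
cf. Definition 2.7, (iii)] and unit-profinite type. Let `(P, F)` be a base-Frobenius pair of `C`;
`A ∈ Ob(P)` a Frobenius-trivial object; `A_D := Base(A)`. Then the pair
`(σ : Aut_D(A_D) ↪ Aut_C(A), φ : N_{≥1} → End_C(A))` — where `σ` is a group homomorphism whose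
composite with the natural surjection `Aut_C(A) ↠ Aut_D(A_D)` [cf. Theorem 5.1, (iii)] is the identity,
and `φ` is a homomorphism of monoids — determined by 'restricting' `P`, `F` to `A`, in fact, depends
only on the data `(C, A)`, and, in particular, is independent of the data `(F, P)` — up to conjugation
[as a pair!] by an element of `O^×(A)`. We shall refer to such a pair `(σ, φ)` as a base-Frobenius pair
of `A`; when `F` is regarded as being known only up to composition with automorphisms of the monoid
`N_{≥1}`, we shall refer to such a pair as a quasi-base-Frobenius pair of `A`."

**Rendering.** Base-Frobenius pairs `(P, F)` of `C` are those of Def. 2.7 (`Presection`,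
`IsBaseFrobeniusPair`, `IsOfUnitProfiniteType`: files `Subcategories.lean`, `BaseFrobeniusSections.lean`,
seat abc-iut-L1-t2). "The pair determined by restricting `P`, `F` to `A`" is characterised by
`IsRestrictedPair`: `σ` is a section of `Aut_C(A) → Aut_D(A_D)` with values in `P`, and
`φ(n) = F(n)_A`. "Of model type" (Def. 4.5 (i)) is bound BY NAME (W2-8 (3)) as pre-model (Def. 2.7
(iii), `IsOfPreModelType` — implied by the existence of `(P, F)`) AND birationally Frobenius-normalized
(`IsOfBiratFrobeniusNormalizedType B`, Def. 4.5 (i), seat abc-iut-L1-t3) over a birationalization datum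
`B : BiratData` of `C` (data-only interface ⇒ SCHEMA-LABEL RULE W2-8 (5): faithful when `B` is THE
birationalization, whose `phiBirat` is the canonical `biratSubfunctor F`, RULING C5′).
`Prop56` (named statement, HARD: 966-word proof via pro-`p` units) and the definitions
`IsBaseFrobeniusPairOfObj` / `IsQuasiBaseFrobeniusPairOfObj` type the Proposition.

**Remark 5.6.1 (p. 107, expository; no mathematical claim).** "The notion of a 'base-section of a
Frobenius-trivial object' [i.e., … a section '`σ`'] is intended to be an abstract category-theoretic
translation of the notion of a 'tautological section of a trivial line bundle' [cf. Remark 2.7.1; the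
Frobenioids of Examples 6.1, 6.3 below]."

**Corollary 5.7 (text, pp. 107–108).** For `i = 1, 2`: `Φ_i` perf-factorial, `D_i` Div-slim, `C_i` of
standard type (`PreFrobenioidData.IsOfStandardType (PreFrobenioidData.ofFunctor Φ_i F_i)`, Def. 3.1 (i),
seat abc-iut-L1-t3; name frozen by L1-lead W2-4), `Ψ : C₁ ⥲ C₂` an equivalence preserving
base-isomorphisms both ways in the group-like case. (i) `Ψ` maps base-sections (resp.
quasi-base-Frobenius pairs) of `C₁` to those of `C₂`; in particular `C₁` is of model type iff `C₂` is.
(ii) `C₁` is of unit-profinite type iff `C₂` is. (iii) For `C₁`, `C₂` of model and unit-profinite type,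
`Ψ` maps every quasi-base-Frobenius pair of a Frobenius-trivial `A₁` to one of a Frobenius-trivial `A₂`.
(iv) If moreover (group-like case) `Ψ` and a quasi-inverse preserve Frobenius degrees, "quasi-" may be
removed in (i), (iii). Rendered as `Cor57i_sections`, `Cor57i_pairs`, `Cor57i_model`, `Cor57ii`,
`Cor57iii`, `Cor57iv` (named statements; "Ψ maps `P` to a base-section" ↦ `Ψ(P)` is contained in a
base-section of `C₂`; model type ↦ `IsOfPreModelType F_i ∧ IsOfBiratFrobeniusNormalizedType B_i` over
birationalization data `B_i` — SCHEMA in `B_i`). No statement is strengthened.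
-/

namespace Literature.AlgebraicGeometry.Frobenioids

open CategoryTheory Opposite

universe w v v' u u'

namespace PreFrobenioid

variable {D : Type u} [Category.{v} D] {Φ : Dᵒᵖ ⥤ CommMonCat.{w}}
  {C : Type u'} [Category.{v'} C] (F : C ⥤ ElemFrobenioid Φ)

/-! ### Proposition 5.6 -/

/-- "The pair `(σ : Aut_D(A_D) ↪ Aut_C(A), φ : N_{≥1} → End_C(A))` determined by 'restricting' `P`,
`F` to `A`" for a base-Frobenius pair `(P, F)` of `C` and `A ∈ Ob(P)` (Prop. 5.6 p. 105): `σ` is a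
group homomorphism whose composite with `Aut_C(A) → Aut_D(A_D)` is the identity and whose values lie in
`P` (so `σ` inverts the bijection `Aut_P(A) ⥲ Aut_D(A_D)` of the equivalence `P ⥲ D`), and
`φ(n) = F(n)_A`. [cite: MochizukiFrdI2008, Prop. 5.6 p.105] -/
structure IsRestrictedPair (P : Presection C) (Fr : ℕ+ →* End P.ι) (A : C)
    (σ : Aut (baseObj F A) →* Aut A) (φ : ℕ+ →* End A) : Prop where
  /-- `A ∈ Ob(P)` -/
  mem : P.obj A
  /-- `Base ∘ σ = id` on `Aut_D(A_D)` -/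
  base_σ : ∀ α : Aut (baseObj F A), (baseFunctor F).mapIso (σ α) = α
  /-- the values of `σ` are `P`-distinguished -/
  σ_mem : ∀ α : Aut (baseObj F A), P.hom (σ α).hom
  /-- `φ(n)` is the component of `F(n)` at `A` -/
  φ_eq : ∀ n : ℕ+, φ n = (Fr n).app ⟨A, mem⟩

/-- Conjugation "[as a pair!] by an element `u ∈ O^×(A)`" relates `(σ, φ)` and `(σ', φ')`
(Prop. 5.6 p. 105). [cite: MochizukiFrdI2008, Prop. 5.6 p.105] -/
def PairConjugate {A : C} (u : Aut A) (σ σ' : Aut (baseObj F A) →* Aut A) (φ φ' : ℕ+ →* End A) :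
    Prop :=
  (∀ α : Aut (baseObj F A), σ' α = u.symm ≪≫ σ α ≪≫ u) ∧ ∀ n : ℕ+, φ' n = u.inv ≫ φ n ≫ u.hom

/-- **Proposition 5.6** (named statement, HARD — proof pp. 106–107): for `C` of model and unit-profinite
type, base-Frobenius pairs `(P, F)`, `(P', F')` of `C` and a Frobenius-trivial `A` lying in both `P`
and `P'`, the pairs `(σ, φ)`, `(σ', φ')` obtained by restriction to `A` are conjugate, as pairs, by an
element of `O^×(A)` ("depends only on the data `(C, A)` … up to conjugation [as a pair!] by an element
of `O^×(A)`"). "Of model type" = pre-model (`IsOfPreModelType`, Def. 2.7 (iii)) and birationally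
Frobenius-normalized (`IsOfBiratFrobeniusNormalizedType B`, Def. 4.5 (i)) for a birationalization datum
`B` of `C` (SCHEMA in `B`, W2-8 (5)); the printed consequence "[any birationally Frobenius-normalized
object is Frobenius-normalized — cf. Prop. 4.4 (ii), (iv)]" (Def. 4.5 (i) p. 86), which is exactly
what the proof uses (p. 106 "since `C`, being of model type, is also of [birationally]
Frobenius-normalized type"), is made an EXPLICIT antecedent `IsOfType (IsFrobeniusNormalized F)` because
the data-only `BiratData` interface does not carry Prop. 4.4 (ii) (finding D-θ-F1, abc-iut-L1-t12).
[cite: MochizukiFrdI2008, Prop. 5.6 p.105] -/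
def Prop56 (B : (PreFrobenioidData.ofFunctor Φ F).BiratData) : Prop :=
  IsFrobenioid F → IsOfPreModelType F → PreFrobenioidData.IsOfBiratFrobeniusNormalizedType B →
    IsOfType (IsFrobeniusNormalized F) → IsOfIsotropicType F → IsOfUnitProfiniteType F →
    ∀ (P : Presection C) (Fr : ℕ+ →* End P.ι) (P' : Presection C) (Fr' : ℕ+ →* End P'.ι),
      IsBaseFrobeniusPair F P Fr → IsBaseFrobeniusPair F P' Fr' →
      ∀ (A : C), IsFrobeniusTrivial F A →
        ∀ (σ σ' : Aut (baseObj F A) →* Aut A) (φ φ' : ℕ+ →* End A),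
          IsRestrictedPair F P Fr A σ φ → IsRestrictedPair F P' Fr' A σ' φ' →
            ∃ u ∈ unitsSubgroup F A, PairConjugate F u σ σ' φ φ'

/-- The restricted pair exists for every object of `P` (the elementary half of "determined by
'restricting' `P`, `F` to `A`": `P ⥲ D` is an equivalence, Def. 2.7 (i)(c)) — named statement.
[cite: MochizukiFrdI2008, Prop. 5.6 p.105] -/
def Prop56_exists : Prop :=
  IsFrobenioid F → ∀ (P : Presection C) (Fr : ℕ+ →* End P.ι), IsBaseFrobeniusPair F P Fr →
    ∀ A : C, P.obj A → ∃ (σ : Aut (baseObj F A) →* Aut A) (φ : ℕ+ →* End A),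
      IsRestrictedPair F P Fr A σ φ

/-- "We shall refer to such a pair `(σ, φ)` as a *base-Frobenius pair of `A`*" (Prop. 5.6 p. 105): a
pair arising by restriction from some base-Frobenius pair `(P, F)` of `C` with `A ∈ Ob(P)`.
[cite: MochizukiFrdI2008, Prop. 5.6 p.105] -/
def IsBaseFrobeniusPairOfObj (A : C) (σ : Aut (baseObj F A) →* Aut A) (φ : ℕ+ →* End A) : Prop :=
  ∃ (P : Presection C) (Fr : ℕ+ →* End P.ι), IsBaseFrobeniusPair F P Fr ∧ IsRestrictedPair F P Fr A σ φ

/-- "When `F` is regarded as being known only up to composition with automorphisms of the monoid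
`N_{≥1}`, we shall refer to such a pair as a *quasi-base-Frobenius pair of `A`*" (Prop. 5.6 p. 106).
[cite: MochizukiFrdI2008, Prop. 5.6 p.106] -/
def IsQuasiBaseFrobeniusPairOfObj (A : C) (σ : Aut (baseObj F A) →* Aut A) (φ : ℕ+ →* End A) :
    Prop :=
  ∃ τ : ℕ+ ≃* ℕ+, IsBaseFrobeniusPairOfObj F A σ (φ.comp τ.toMonoidHom)

end PreFrobenioid

/-! ### Corollary 5.7 -/

namespace PreFrobenioid

section Cor57

variable {D₁ : Type u} [Category.{v} D₁] {Φ₁ : D₁ᵒᵖ ⥤ CommMonCat.{w}}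
  {C₁ : Type u'} [Category.{v'} C₁] (F₁ : C₁ ⥤ ElemFrobenioid Φ₁)
  {D₂ : Type u} [Category.{v} D₂] {Φ₂ : D₂ᵒᵖ ⥤ CommMonCat.{w}}
  {C₂ : Type u'} [Category.{v'} C₂] (F₂ : C₂ ⥤ ElemFrobenioid Φ₂)

/-- The standing hypotheses of Corollary 5.7 (pp. 107–108): `Φ_i` perf-factorial divisorial monoids on
connected, totally epimorphic, Div-slim `D_i`; `C_i → F_{Φ_i}` Frobenioids of standard type; for the
equivalence `Ψ`: "if `C₁`, `C₂` are of group-like type, then … both `Ψ` and some quasi-inverse to `Ψ`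
preserve base-isomorphisms". [cite: MochizukiFrdI2008, Cor. 5.7 p.107] -/
structure Cor57Hypotheses (Ψ : C₁ ≌ C₂) : Prop where
  /-- `C₁` is a Frobenioid -/
  isFrobenioid₁ : IsFrobenioid F₁
  /-- `C₂` is a Frobenioid -/
  isFrobenioid₂ : IsFrobenioid F₂
  /-- `Φ₁` is perf-factorial -/
  perfFactorial₁ : Objectwise (fun M _ => IsPerfFactorial M) Φ₁
  /-- `Φ₂` is perf-factorial -/
  perfFactorial₂ : Objectwise (fun M _ => IsPerfFactorial M) Φ₂
  /-- `D₁` is Div-slim -/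
  divSlim₁ : (PreFrobenioidData.ofFunctor Φ₁ F₁).IsDivSlim
  /-- `D₂` is Div-slim -/
  divSlim₂ : (PreFrobenioidData.ofFunctor Φ₂ F₂).IsDivSlim
  /-- `C₁` is of standard type -/
  standard₁ : (PreFrobenioidData.ofFunctor Φ₁ F₁).IsOfStandardType
  /-- `C₂` is of standard type -/
  standard₂ : (PreFrobenioidData.ofFunctor Φ₂ F₂).IsOfStandardType
  /-- in the group-like case `Ψ` preserves base-isomorphisms … -/
  baseIso_functor : IsOfType (IsGroupLikeObj F₁) → IsOfType (IsGroupLikeObj F₂) →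
    ∀ ⦃A B : C₁⦄ (f : A ⟶ B), IsBaseIso F₁ f → IsBaseIso F₂ (Ψ.functor.map f)
  /-- … and so does a quasi-inverse -/
  baseIso_inverse : IsOfType (IsGroupLikeObj F₁) → IsOfType (IsGroupLikeObj F₂) →
    ∀ ⦃A B : C₂⦄ (g : A ⟶ B), IsBaseIso F₂ g → IsBaseIso F₁ (Ψ.inverse.map g)

/-- "`Ψ` maps the subcategory `P₁` into `P₂`" (objects and distinguished arrows).
[cite: MochizukiFrdI2008, Cor. 5.7 (i) p.108] -/
def MapsInto (Ψ : C₁ ≌ C₂) (P₁ : Presection C₁) (P₂ : Presection C₂) : Prop :=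
  (∀ A : C₁, P₁.obj A → P₂.obj (Ψ.functor.obj A)) ∧
    ∀ ⦃A B : C₁⦄ (f : A ⟶ B), P₁.hom f → P₂.hom (Ψ.functor.map f)

/-- **Corollary 5.7 (i)**, base-sections (named statement): "`Ψ` maps base-sections … of `C₁` to
base-sections … of `C₂`" — every base-section `P₁` of `C₁` is mapped by `Ψ` into a base-section of
`C₂`. [cite: MochizukiFrdI2008, Cor. 5.7 (i) p.108] -/
def Cor57i_sections (Ψ : C₁ ≌ C₂) : Prop :=
  Cor57Hypotheses F₁ F₂ Ψ → ∀ P₁ : Presection C₁, IsBaseSection F₁ P₁ →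
    ∃ P₂ : Presection C₂, IsBaseSection F₂ P₂ ∧ MapsInto Ψ P₁ P₂

/-- **Corollary 5.7 (i)**, quasi-base-Frobenius pairs (named statement): `Ψ` maps every base-Frobenius
pair `(P₁, F₁)` of `C₁` into a base-Frobenius pair `(P₂, F₂)` of `C₂`, the Frobenius-sections matching
up to an automorphism `τ` of `N_{≥1}` ("quasi-"): `Ψ(F₁(n)_A) = F₂(τ n)_{Ψ A}`.
[cite: MochizukiFrdI2008, Cor. 5.7 (i) p.108] -/
def Cor57i_pairs (Ψ : C₁ ≌ C₂) : Prop :=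
  Cor57Hypotheses F₁ F₂ Ψ → ∀ (P₁ : Presection C₁) (Fr₁ : ℕ+ →* End P₁.ι),
    IsBaseFrobeniusPair F₁ P₁ Fr₁ →
      ∃ (P₂ : Presection C₂) (Fr₂ : ℕ+ →* End P₂.ι) (τ : ℕ+ ≃* ℕ+) (h : MapsInto Ψ P₁ P₂),
        IsBaseFrobeniusPair F₂ P₂ Fr₂ ∧
          ∀ (n : ℕ+) (A : C₁) (hA : P₁.obj A),
            Ψ.functor.map ((Fr₁ n).app ⟨A, hA⟩) = (Fr₂ (τ n)).app ⟨Ψ.functor.obj A, h.1 A hA⟩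

/-- **Corollary 5.7 (i)**, "In particular, `C₁` is of model type if and only if `C₂` is" (named
statement; SCHEMA in the birationalization data `B₁`, `B₂` of `C₁`, `C₂`): model type = pre-model
(`IsOfPreModelType`, Def. 2.7 (iii)) AND birationally Frobenius-normalized
(`IsOfBiratFrobeniusNormalizedType B_i`, Def. 4.5 (i)); the pre-model equivalence is also stated alone.
[cite: MochizukiFrdI2008, Cor. 5.7 (i) p.108] -/
def Cor57i_model (Ψ : C₁ ≌ C₂) (B₁ : (PreFrobenioidData.ofFunctor Φ₁ F₁).BiratData)
    (B₂ : (PreFrobenioidData.ofFunctor Φ₂ F₂).BiratData) : Prop :=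
  Cor57Hypotheses F₁ F₂ Ψ →
    (IsOfPreModelType F₁ ↔ IsOfPreModelType F₂) ∧
      ((IsOfPreModelType F₁ ∧ PreFrobenioidData.IsOfBiratFrobeniusNormalizedType B₁) ↔
        (IsOfPreModelType F₂ ∧ PreFrobenioidData.IsOfBiratFrobeniusNormalizedType B₂))

/-- **Corollary 5.7 (ii)** (named statement): "`C₁` is of unit-profinite type if and only if `C₂` is."
[cite: MochizukiFrdI2008, Cor. 5.7 (ii) p.108] -/
def Cor57ii (Ψ : C₁ ≌ C₂) : Prop :=
  Cor57Hypotheses F₁ F₂ Ψ → (IsOfUnitProfiniteType F₁ ↔ IsOfUnitProfiniteType F₂)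

/-- "`Ψ` maps the pair `(σ₁, φ₁)` at `A₁` to the pair `(σ₂, φ₂)` at `Ψ(A₁)`, up to the automorphism `τ`
of `N_{≥1}`": the images of `σ₁` and `σ₂` correspond under `Ψ` and `Ψ(φ₁(n)) = φ₂(τ n)`.
[cite: MochizukiFrdI2008, Cor. 5.7 (iii) p.108] -/
def MapsPair (Ψ : C₁ ≌ C₂) {A₁ : C₁} (σ₁ : Aut (baseObj F₁ A₁) →* Aut A₁) (φ₁ : ℕ+ →* End A₁)
    (σ₂ : Aut (baseObj F₂ (Ψ.functor.obj A₁)) →* Aut (Ψ.functor.obj A₁))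
    (φ₂ : ℕ+ →* End (Ψ.functor.obj A₁)) (τ : ℕ+ ≃* ℕ+) : Prop :=
  (∀ α, ∃ β, σ₂ β = Ψ.functor.mapIso (σ₁ α)) ∧ (∀ β, ∃ α, σ₂ β = Ψ.functor.mapIso (σ₁ α)) ∧
    ∀ n : ℕ+, Ψ.functor.map (φ₁ n) = φ₂ (τ n)

/-- **Corollary 5.7 (iii)** (named statement; SCHEMA in `B₁`, `B₂`): for `C₁`, `C₂` of model (pre-model
and birationally Frobenius-normalized w.r.t. birationalization data `B_i`) and unit-profinite type,
"`Ψ` maps every quasi-base-Frobenius pair of a Frobenius-trivial object `A₁ ∈ Ob(C₁)` to a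
quasi-base-Frobenius pair of a Frobenius-trivial object `A₂ ∈ Ob(C₂)`" (`A₂ = Ψ(A₁)`).
[cite: MochizukiFrdI2008, Cor. 5.7 (iii) p.108] -/
def Cor57iii (Ψ : C₁ ≌ C₂) (B₁ : (PreFrobenioidData.ofFunctor Φ₁ F₁).BiratData)
    (B₂ : (PreFrobenioidData.ofFunctor Φ₂ F₂).BiratData) : Prop :=
  Cor57Hypotheses F₁ F₂ Ψ →
    IsOfPreModelType F₁ → PreFrobenioidData.IsOfBiratFrobeniusNormalizedType B₁ →
    IsOfPreModelType F₂ → PreFrobenioidData.IsOfBiratFrobeniusNormalizedType B₂ →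
    IsOfUnitProfiniteType F₁ → IsOfUnitProfiniteType F₂ →
    ∀ (A₁ : C₁) (σ₁ : Aut (baseObj F₁ A₁) →* Aut A₁) (φ₁ : ℕ+ →* End A₁),
      IsFrobeniusTrivial F₁ A₁ → IsQuasiBaseFrobeniusPairOfObj F₁ A₁ σ₁ φ₁ →
        IsFrobeniusTrivial F₂ (Ψ.functor.obj A₁) ∧
          ∃ (σ₂ : Aut (baseObj F₂ (Ψ.functor.obj A₁)) →* Aut (Ψ.functor.obj A₁))
            (φ₂ : ℕ+ →* End (Ψ.functor.obj A₁)) (τ : ℕ+ ≃* ℕ+),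
            IsQuasiBaseFrobeniusPairOfObj F₂ (Ψ.functor.obj A₁) σ₂ φ₂ ∧ MapsPair F₁ F₂ Ψ σ₁ φ₁ σ₂ φ₂ τ

/-- **Corollary 5.7 (iv)** (named statement): "Suppose, moreover, when `C₁`, `C₂` are of group-like
type, that both `Ψ` and some quasi-inverse to `Ψ` preserve Frobenius degrees. Then the prefix 'quasi-'
may be removed from the statements of (i), (iii)": base-Frobenius pairs of `C₁` go to base-Frobenius
pairs of `C₂` with `τ = id`, and base-Frobenius pairs of Frobenius-trivial objects likewise (SCHEMA in
the birationalization data `B₁`, `B₂` entering "model type"). [cite: MochizukiFrdI2008, Cor. 5.7 (iv) p.108] -/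
def Cor57iv (Ψ : C₁ ≌ C₂) (B₁ : (PreFrobenioidData.ofFunctor Φ₁ F₁).BiratData)
    (B₂ : (PreFrobenioidData.ofFunctor Φ₂ F₂).BiratData) : Prop :=
  Cor57Hypotheses F₁ F₂ Ψ →
    (IsOfType (IsGroupLikeObj F₁) → IsOfType (IsGroupLikeObj F₂) →
      (∀ ⦃A B : C₁⦄ (f : A ⟶ B), degFr F₂ (Ψ.functor.map f) = degFr F₁ f) ∧
        ∀ ⦃A B : C₂⦄ (g : A ⟶ B), degFr F₁ (Ψ.inverse.map g) = degFr F₂ g) →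
    (∀ (P₁ : Presection C₁) (Fr₁ : ℕ+ →* End P₁.ι), IsBaseFrobeniusPair F₁ P₁ Fr₁ →
        ∃ (P₂ : Presection C₂) (Fr₂ : ℕ+ →* End P₂.ι) (h : MapsInto Ψ P₁ P₂),
          IsBaseFrobeniusPair F₂ P₂ Fr₂ ∧
            ∀ (n : ℕ+) (A : C₁) (hA : P₁.obj A),
              Ψ.functor.map ((Fr₁ n).app ⟨A, hA⟩) = (Fr₂ n).app ⟨Ψ.functor.obj A, h.1 A hA⟩) ∧
      (IsOfPreModelType F₁ → PreFrobenioidData.IsOfBiratFrobeniusNormalizedType B₁ →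
        IsOfPreModelType F₂ → PreFrobenioidData.IsOfBiratFrobeniusNormalizedType B₂ →
        IsOfUnitProfiniteType F₁ → IsOfUnitProfiniteType F₂ →
        ∀ (A₁ : C₁) (σ₁ : Aut (baseObj F₁ A₁) →* Aut A₁) (φ₁ : ℕ+ →* End A₁),
          IsFrobeniusTrivial F₁ A₁ → IsBaseFrobeniusPairOfObj F₁ A₁ σ₁ φ₁ →
            ∃ σ₂ φ₂, IsBaseFrobeniusPairOfObj F₂ (Ψ.functor.obj A₁) σ₂ φ₂ ∧
              MapsPair F₁ F₂ Ψ σ₁ φ₁ σ₂ φ₂ (MulEquiv.refl ℕ+))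

end Cor57

end PreFrobenioid

end Literature.AlgebraicGeometry.Frobenioids
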